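import Summits.QuantumFields.YangMills.Theorems.ColdStartUniversalityShenZhuZhuLinkSusceptibilitySU2
import Summits.Ventures.YMGap.Thresholds.LatticeBakryEmeryPoincare
import Summits.Ventures.YMGap.Thresholds.LatticeBakryEmeryWilson
import Summits.Ventures.YMGap.Thresholds.SharpWindow
import Literature.MathematicalPhysics.QuantumFieldTheory.WilsonEnergyConvexity
import HarnessLib

/-!
# Shen–Zhu–Zhu's Corollary 4.7 for EVERY `SU(N)` and EVERY dimension `d`: the susceptibility of the link field on every torus,
# `0 ≤ Σ_e Cov_{Λ_L,Nβ}(⟨Q_{e₀},E⟩, ⟨Q_e,E⟩) ≤ ‖E‖_F²/(N/2 − 4dN|β|)` for `|β| < 1/(8d)`; the named facts `shenZhuZhu_linkSusceptibility d N` for `N ≤ 2`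

Seat `ym-line-csu-p1` (g39), route `ColdStartUniversality` of `Summits/QuantumFields/YangMills`, helper file G21 (fixed lattice, strong
coupling; `--supports stmt-QuantumFields-24809`).  G19 proved SZZ Cor. 4.7 for `SU(2)`, `d = 3` from the seat's own Bakry–Émery package.  This
file does it for ALL `N ≥ 1`, `d ≥ 1` from the kernel-checked MULTI-LINK BAKRY–ÉMERY POINCARÉ INEQUALITY of the venture `YMGap`
(`LatticeBakryEmery.poincare_gibbs_lipschitz`, with the venture's Hessian constant `WilsonHessianBound d N (4d)`, `HessianSharp.wilsonHessianBound_four_d`):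

* §1 `torus_variance_le_of_linkLipschitz_sun` — the torus Poincaré inequality in Lipschitz form for 't Hooft-scaled `SU(N)` lattice Yang–Mills,
  every torus `(ℤ/L)^d`: `Var_{μ_{Λ_L,Nβ}}(f) ≤ (Σ_e L_e²)/(N/2 − 4dN|β|)` for smooth `f` that is `L_e`-Lipschitz in the link `e` (Frobenius
  distance).  Adapted from the venture leaf `Thresholds/SharpPoincare.lean` (`torus_variance_le`), which is NOT built on the farm; its imports are.
* §2 `linkLipschitz_linkFieldSum`, `linkLipschitz_linkField`, ★ `torus_linkFieldSum_variance_sun` (`Var(Σ_e ⟨Q_e,E⟩) ≤ |E⁺|‖E‖_F²/K`),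
  `torus_linkField_variance_sun` (`Var(⟨Q_e,E⟩) ≤ ‖E‖_F²/K`), `K = N/2 − 4dN|β|`.
* §3 ★★★ `torus_linkSusceptibility_sun` — `0 ≤ Σ_e Cov_{Λ_L,Nβ}(⟨Q_{e₀},E⟩, ⟨Q_e,E⟩) ≤ ‖E‖_F²/K` for every `L`, `e₀`, `E` (G19's lattice symmetry
  `variance_sum_linkObs_eq`: translations and axis permutations act transitively on links); ★★ `torus_linkSusceptibility_offDiag_sun`.
* §4 ★★★ `szzLinkSusceptibilityBound_sun` — `SZZLinkSusceptibilityBound (fundamentalRep (Fin N)) d (Nβ) 2 K'` for every `0 < K' ≤ K` (SZZ print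
  `γ = 2`; the tree's normalisation gives `1/K`); ★★★ `shenZhuZhu_linkSusceptibility_of_le_two` — the NAMED FACT `shenZhuZhu_linkSusceptibility d N`
  for `N ≤ 2` and every `d` (SZZ window `|β| < 1/(16(d−1)) ≤ 1/(8d)`, `K_S = N/2 − 8N(d−1)|β| ≤ K`; for `N ≤ 2` the `SO(N)` conjunct is vacuous since
  SZZ's threshold `1/(32(d−1)) − 1/(16N(d−1)) ≤ 0`).  For `N ≥ 3` the `SO(N)` conjunct needs the `SO(N)` Poincaré inequality, not in the tree.

THEOREMS ONLY, no definition, no sorry.  HONEST FRAMING: STRONG coupling (`|β| < 1/(8d)`), FIXED finite tori; a vendored LITERATURE statement is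
discharged for `N ∈ {1, 2}` (all `d`); nothing at weak coupling / in the continuum, nothing `K`-uniform along the route's scaling
(`UniformColdStartMixing`, 24809, ASIDE, not restated); no crux, rung or summit statement is proved; the Yang–Mills mass gap is NOT proved.

References: H. Shen, R. Zhu, X. Zhu, CMP 400 (2023) 805–851 = arXiv:2204.12737, Cor. 4.7 (p. 20–21), Cor. 4.4 (4.11) [ShenZhuZhu2022];
D. Bakry, M. Émery, LNM 1123 (1985); Bakry–Gentil–Ledoux, Grundlehren 348, Prop. 4.8.1.
-/

set_option autoImplicit false

noncomputable section

namespace Summit.QuantumFields.YangMills.Theorems.ColdStartUniversality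

open MeasureTheory ProbabilityTheory Finset Filter Set Function
open scoped BigOperators NNReal ENNReal Topology Matrix Matrix.Norms.Frobenius ContDiff
open Literature.MathematicalPhysics.QuantumFieldTheory
open Literature.MathematicalPhysics.QuantumLattice (fundamentalRep continuous_fundamentalRep fundamentalRep_apply)
open Literature.MathematicalPhysics.QuantumFieldTheory.SUNBakryEmery (SUN)
open Summit.Ventures.YMGap.LatticeBakryEmery (PSU Cfg emb emb_apply haarPi LinkLipschitz wilsonPot wilsonPot_mem_polySpace
  hessBound_wilsonPot contDiff_wilsonPot exp_neg_mul_wilsonAction_eq poincare_gibbs_lipschitz integrable_of_continuous_PSU continuous_restrict)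
open Summit.Ventures.YMGap.HessianSharp (wilsonHessianBound_four_d)

universe u

/-! ## §1. The torus Poincaré inequality in Lipschitz form for every `SU(N)` and every `d` -/

section Torus

variable {d N L : ℕ} [NeZero L]

/-- ★★ **Torus Poincaré inequality, Lipschitz form, every `SU(N)`, every `d`** (Shen–Zhu–Zhu Cor. 4.4 (4.11) with the venture's sharp Hessian
constant `4d` in place of `8(d−1)`): for `K = N/2 − 4dN|β| > 0` (`|β| < 1/(8d)`), every torus `(ℤ/L)^d` and every smooth function `f` of the link
matrices that is `L_e`-Lipschitz in the link `e` (Frobenius distance), `Var_{μ_{Λ_L,Nβ}}(f) ≤ (Σ_e L_e²)/K`.  Kernel theorem (multi-link Bakry–Émery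
Poincaré inequality `poincare_gibbs_lipschitz` of the venture `YMGap`); adapted from `Summits/Ventures/YMGap/Thresholds/SharpPoincare.lean`
(`torus_variance_le`, unbuilt leaf).  The Yang–Mills mass gap is NOT proved. [cite: ShenZhuZhu2022, Corollary 4.4 (4.11)] -/
theorem torus_variance_le_of_linkLipschitz_sun (hN : N ≠ 0) {β : ℝ} (hK : 0 < (N : ℝ) / 2 - N * |β| * (4 * d))
    {f : Cfg (Edge d L) N → ℝ} (hf : ContDiff ℝ ∞ f) {Lc : Edge d L → ℝ} (hL : ∀ e, 0 ≤ Lc e) (hLip : LinkLipschitz f Lc) :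
    Var[fun U : GaugeConfig d L (SUN N) => f (emb U); wilsonMeasure (d := d) (L := L) (fundamentalRep (Fin N)) ((N : ℝ) * β)] ≤
      (∑ e, Lc e ^ 2) / ((N : ℝ) / 2 - N * |β| * (4 * d)) := by
  -- adapted from Summits/Ventures/YMGap/Thresholds/SharpPoincare.lean (`integral_wilsonMeasure_eq_div`, `torus_variance_le`)
  set μ := wilsonMeasure (d := d) (L := L) (fundamentalRep (Fin N)) ((N : ℝ) * β) with hμ
  set S := wilsonPot d N L β with hS
  set Z : ℝ := ∫ U, Real.exp (S (emb U)) ∂(haarPi (Edge d L) N) with hZ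
  -- torus expectations as `e^S`-weighted product-Haar averages (the constant `e^{-N²β|P|}` cancels)
  have hrep : ∀ φ : PSU (Edge d L) N → ℝ,
      ∫ U, φ U ∂μ = (∫ U, Real.exp (S (emb U)) * φ U ∂(haarPi (Edge d L) N)) / Z := by
    intro φ
    have h := wilsonExpectation_eq_integral_div (d := d) (L := L) (fundamentalRep (Fin N))
      (continuous_fundamentalRep (n := Fin N)) ((N : ℝ) * β) φ
    unfold wilsonExpectation at h
    rw [hμ, h]
    set C : ℝ := Real.exp (-((N : ℝ) * β * N * Fintype.card (Plaquette d L))) with hC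
    have hCpos : 0 < C := Real.exp_pos _
    have e1 : (fun U : GaugeConfig d L (SUN N) => φ U * Real.exp (-((N : ℝ) * β) * wilsonAction (fundamentalRep (Fin N)) U))
        = fun U => C * (Real.exp (S (emb U)) * φ U) := by
      funext U; rw [exp_neg_mul_wilsonAction_eq]; ring
    have e2 : (fun U : GaugeConfig d L (SUN N) => Real.exp (-((N : ℝ) * β) * wilsonAction (fundamentalRep (Fin N)) U))
        = fun U => C * Real.exp (S (emb U)) := by
      funext U; rw [exp_neg_mul_wilsonAction_eq]
    show (∫ U, φ U * Real.exp (-((N : ℝ) * β) * wilsonAction (fundamentalRep (Fin N)) U) ∂(haarPi (Edge d L) N)) /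
        (∫ U, Real.exp (-((N : ℝ) * β) * wilsonAction (fundamentalRep (Fin N)) U) ∂(haarPi (Edge d L) N)) = _
    rw [e1, e2, integral_const_mul, integral_const_mul, mul_div_mul_left _ _ hCpos.ne']
  have hSc : Continuous fun U : PSU (Edge d L) N => S (emb U) := continuous_restrict (contDiff_wilsonPot β)
  have hZpos : 0 < Z := integral_exp_pos (integrable_of_continuous_PSU (Real.continuous_exp.comp hSc) _)
  have hφc : Continuous fun U : PSU (Edge d L) N => f (emb U) := continuous_restrict hf
  set m : ℝ := (∫ U, Real.exp (S (emb U)) * f (emb U) ∂(haarPi (Edge d L) N)) / Z with hm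
  have hmean : ∫ U, f (emb U) ∂μ = m := hrep _
  have hvar : Var[fun U => f (emb U); μ] =
      (∫ U, Real.exp (S (emb U)) * (f (emb U) - m) ^ 2 ∂(haarPi (Edge d L) N)) / Z := by
    rw [variance_eq_integral hφc.measurable.aemeasurable]
    simp only [hmean]
    exact hrep _
  have hP := poincare_gibbs_lipschitz (ι := Edge d L) hN (wilsonPot_mem_polySpace β)
    (hessBound_wilsonPot (wilsonHessianBound_four_d d N) β) hK hf hL hLip
  rw [hvar, div_le_div_iff₀ hZpos hK, mul_comm]
  exact hP

end Torus

/-! ## §2. The link field: Lipschitz constants and variances -/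

section LinkField

variable {d N L : ℕ} [NeZero L]

/-- The ambient function `Q ↦ Re Tr(Q_e Eᴴ)` is smooth (a continuous linear functional of one coordinate). [cite: ShenZhuZhu2022, (2.3)] -/
theorem contDiff_linkHSField (E : Matrix (Fin N) (Fin N) ℂ) (e : Edge d L) :
    ContDiff ℝ ∞ fun Q : Cfg (Edge d L) N => (Q e * Eᴴ).trace.re := by
  have hlin : ContDiff ℝ ∞ (fun M : Matrix (Fin N) (Fin N) ℂ => (M * Eᴴ).trace.re) := by
    let T : Matrix (Fin N) (Fin N) ℂ →L[ℝ] ℝ :=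
      LinearMap.toContinuousLinearMap
        { toFun := fun M => (M * Eᴴ).trace.re
          map_add' := fun A B => by simp [Matrix.add_mul, Matrix.trace_add]
          map_smul' := fun r A => by simp [Matrix.trace_smul] }
    exact T.contDiff
  exact hlin.comp (contDiff_apply ℝ (Matrix (Fin N) (Fin N) ℂ) e)

/-- **The total link field `Σ_e Re Tr(Q_e Eᴴ)` is `‖E‖_F`-Lipschitz in every link** (Cauchy–Schwarz for the Hilbert–Schmidt pairing).
[cite: ShenZhuZhu2022, Corollary 4.7] -/
theorem linkLipschitz_linkFieldSum (E : Matrix (Fin N) (Fin N) ℂ) :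
    LinkLipschitz (fun Q : Cfg (Edge d L) N => ∑ e, (Q e * Eᴴ).trace.re) (fun _ => frobNorm E) := by
  classical
  intro e g h hgh
  dsimp only
  rw [← Finset.sum_sub_distrib, Finset.sum_eq_single e]
  · rw [show (emb g e * Eᴴ).trace.re - (emb h e * Eᴴ).trace.re = ((emb g e - emb h e) * Eᴴ).trace.re by
      rw [Matrix.sub_mul, Matrix.trace_sub, Complex.sub_re]]
    refine (abs_re_trace_mul_le _ _).trans (le_of_eq ?_)
    rw [frobNorm_conjTranspose, mul_comm]
    rfl
  · intro e' _ hne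
    rw [emb_apply, emb_apply, hgh e' hne, sub_self]
  · intro h'; exact absurd (Finset.mem_univ e) h'

omit [NeZero L] in
/-- **One link field `Re Tr(Q_{e₀} Eᴴ)` is `‖E‖_F`-Lipschitz in `e₀` and constant in the other links.** [cite: ShenZhuZhu2022, Corollary 4.7] -/
theorem linkLipschitz_linkField (E : Matrix (Fin N) (Fin N) ℂ) (e₀ : Edge d L) :
    LinkLipschitz (fun Q : Cfg (Edge d L) N => (Q e₀ * Eᴴ).trace.re) (fun e => if e = e₀ then frobNorm E else 0) := by
  intro e g h hgh
  dsimp only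
  by_cases he : e = e₀
  · subst he
    rw [if_pos rfl, show (emb g e * Eᴴ).trace.re - (emb h e * Eᴴ).trace.re = ((emb g e - emb h e) * Eᴴ).trace.re by
      rw [Matrix.sub_mul, Matrix.trace_sub, Complex.sub_re]]
    refine (abs_re_trace_mul_le _ _).trans (le_of_eq ?_)
    rw [frobNorm_conjTranspose, mul_comm]
    rfl
  · rw [if_neg he, zero_mul, emb_apply, emb_apply, hgh e₀ (Ne.symm he), sub_self, abs_zero]

/-- ★ **Variance of the TOTAL link field on every torus, every `SU(N)`, every `d`**: for `K = N/2 − 4dN|β| > 0`,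
`Var_{μ_{Λ_L,Nβ}}(Σ_e ⟨Q_e,E⟩) ≤ |E⁺_{Λ_L}|·‖E‖_F²/K`.  The Yang–Mills mass gap is NOT proved. [cite: ShenZhuZhu2022, Corollary 4.7] -/
theorem torus_linkFieldSum_variance_sun (hN : N ≠ 0) {β : ℝ} (hK : 0 < (N : ℝ) / 2 - N * |β| * (4 * d)) (E : Matrix (Fin N) (Fin N) ℂ) :
    Var[fun U : GaugeConfig d L (SUN N) => ∑ e, linkHSComponent (fundamentalRep (Fin N)) E e U;
        wilsonMeasure (d := d) (L := L) (fundamentalRep (Fin N)) ((N : ℝ) * β)] ≤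
      (Fintype.card (Edge d L) : ℝ) * frobNorm E ^ 2 / ((N : ℝ) / 2 - N * |β| * (4 * d)) := by
  have h := torus_variance_le_of_linkLipschitz_sun (L := L) hN hK (f := fun Q : Cfg (Edge d L) N => ∑ e, (Q e * Eᴴ).trace.re)
    (ContDiff.sum fun e _ => contDiff_linkHSField E e) (fun _ => frobNorm_nonneg E) (linkLipschitz_linkFieldSum E)
  have hfun : (fun U : GaugeConfig d L (SUN N) => ∑ e, (emb U e * Eᴴ).trace.re) =
      fun U => ∑ e, linkHSComponent (fundamentalRep (Fin N)) E e U := by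
    funext U; simp only [emb_apply, linkHSComponent_apply, fundamentalRep_apply]
  rw [hfun] at h
  refine h.trans (le_of_eq ?_)
  rw [Finset.sum_const, Finset.card_univ, nsmul_eq_mul]

/-- ★ **Variance of one link field on every torus, every `SU(N)`, every `d`** (SZZ's diagonal input `Var(⟨Q_e,E⟩) ≤ γ/K_S` of Cor. 4.7):
`Var_{μ_{Λ_L,Nβ}}(⟨Q_{e₀},E⟩) ≤ ‖E‖_F²/K`, `K = N/2 − 4dN|β|`.  The Yang–Mills mass gap is NOT proved. [cite: ShenZhuZhu2022, Corollary 4.7] -/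
theorem torus_linkField_variance_sun (hN : N ≠ 0) {β : ℝ} (hK : 0 < (N : ℝ) / 2 - N * |β| * (4 * d)) (E : Matrix (Fin N) (Fin N) ℂ)
    (e₀ : Edge d L) :
    Var[linkHSComponent (fundamentalRep (Fin N)) E e₀; wilsonMeasure (d := d) (L := L) (fundamentalRep (Fin N)) ((N : ℝ) * β)] ≤
      frobNorm E ^ 2 / ((N : ℝ) / 2 - N * |β| * (4 * d)) := by
  have h := torus_variance_le_of_linkLipschitz_sun (L := L) hN hK (f := fun Q : Cfg (Edge d L) N => (Q e₀ * Eᴴ).trace.re)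
    (contDiff_linkHSField E e₀) (fun e => by split_ifs; exacts [frobNorm_nonneg E, le_rfl]) (linkLipschitz_linkField E e₀)
  have hfun : (fun U : GaugeConfig d L (SUN N) => (emb U e₀ * Eᴴ).trace.re) = linkHSComponent (fundamentalRep (Fin N)) E e₀ := by
    funext U; simp only [emb_apply, linkHSComponent_apply, fundamentalRep_apply]
  rw [hfun] at h
  refine h.trans (le_of_eq ?_)
  rw [Finset.sum_eq_single e₀ (fun e _ hne => by rw [if_neg hne]; ring) (fun h' => absurd (Finset.mem_univ _) h'), if_pos rfl]

/-! ## §3. Shen–Zhu–Zhu's Corollary 4.7 for every `SU(N)` and every `d` -/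

/-- ★★★ **Susceptibility of the link field (SZZ Cor. 4.7) for EVERY `SU(N)`, EVERY `d`, EVERY volume**: for `K = N/2 − 4dN|β| > 0` (`|β| < 1/(8d)`),
every torus `(ℤ/L)^d`, every link `e₀` and every matrix `E`,  `0 ≤ Σ_{e ∈ E⁺_{Λ_L}} Cov_{μ_{Λ_L,Nβ}}(⟨Q_{e₀},E⟩, ⟨Q_e,E⟩) ≤ ‖E‖_F²/K`  (the row sum
is `Var(Σ_e⟨Q_e,E⟩)/|E⁺|` since translations and axis permutations act transitively on links).  SZZ print `2/K_S` for unit `E`.  The Yang–Mills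
mass gap is NOT proved. [cite: ShenZhuZhu2022, Corollary 4.7] -/
theorem torus_linkSusceptibility_sun (hN : N ≠ 0) {β : ℝ} (hK : 0 < (N : ℝ) / 2 - N * |β| * (4 * d)) (e₀ : Edge d L)
    (E : Matrix (Fin N) (Fin N) ℂ) :
    0 ≤ ∑ e, cov[linkHSComponent (fundamentalRep (Fin N)) E e₀, linkHSComponent (fundamentalRep (Fin N)) E e;
        wilsonMeasure (d := d) (L := L) (fundamentalRep (Fin N)) ((N : ℝ) * β)] ∧
    ∑ e, cov[linkHSComponent (fundamentalRep (Fin N)) E e₀, linkHSComponent (fundamentalRep (Fin N)) E e;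
        wilsonMeasure (d := d) (L := L) (fundamentalRep (Fin N)) ((N : ℝ) * β)] ≤ frobNorm E ^ 2 / ((N : ℝ) / 2 - N * |β| * (4 * d)) := by
  haveI : IsProbabilityMeasure (wilsonMeasure (d := d) (L := L) (fundamentalRep (Fin N)) ((N : ℝ) * β)) :=
    isProbabilityMeasure_wilsonMeasure (d := d) (L := L) (fundamentalRep (Fin N)) (continuous_fundamentalRep (Fin N)) _
  obtain ⟨g, hg⟩ : ∃ g : SUN N → ℝ, g = fun U => ((fundamentalRep (Fin N) U : Matrix (Fin N) (Fin N) ℂ) * Eᴴ).trace.re := ⟨_, rfl⟩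
  have hgc : Continuous g := by
    rw [hg]
    exact Complex.continuous_re.comp ((continuous_id.matrix_trace).comp
      (((continuous_fundamentalRep (n := Fin N)).matrix_mul continuous_const)))
  have hX : ∀ e : Edge d L, linkHSComponent (fundamentalRep (Fin N)) E e = fun V : GaugeConfig d L (SUN N) => g (V e) := by
    intro e; funext V; rw [hg, linkHSComponent_apply]
  have hcard : (0 : ℝ) < Fintype.card (Edge d L) := by exact_mod_cast Fintype.card_pos_iff.2 ⟨e₀⟩
  have hkey := variance_sum_linkObs_eq (d := d) (L := L) (fundamentalRep (Fin N)) (continuous_fundamentalRep (Fin N)) ((N : ℝ) * β) hgc e₀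
  have hvar := torus_linkFieldSum_variance_sun (d := d) (L := L) hN hK E
  have hnn : 0 ≤ Var[fun V : GaugeConfig d L (SUN N) => ∑ e, g (V e); wilsonMeasure (d := d) (L := L) (fundamentalRep (Fin N)) ((N : ℝ) * β)] :=
    variance_nonneg _ _
  simp only [hX] at hvar ⊢
  rw [hkey] at hvar hnn
  constructor
  · exact le_of_mul_le_mul_left (by rw [mul_zero]; exact hnn) hcard
  · rw [mul_div_assoc] at hvar
    exact le_of_mul_le_mul_left hvar hcard

/-- ★★ **Off-diagonal link susceptibility (SZZ Cor. 4.7, "in particular") for every `SU(N)`, every `d`**: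
`|Σ_{e ≠ e₀} Cov_{μ_{Λ_L,Nβ}}(⟨Q_{e₀},E⟩, ⟨Q_e,E⟩)| ≤ ‖E‖_F²/K` (row sum and diagonal term both lie in `[0, ‖E‖_F²/K]`; SZZ print `4/K_S`).
The Yang–Mills mass gap is NOT proved. [cite: ShenZhuZhu2022, Corollary 4.7] -/
theorem torus_linkSusceptibility_offDiag_sun (hN : N ≠ 0) {β : ℝ} (hK : 0 < (N : ℝ) / 2 - N * |β| * (4 * d)) (e₀ : Edge d L)
    (E : Matrix (Fin N) (Fin N) ℂ) :
    |∑ e ∈ Finset.univ.erase e₀, cov[linkHSComponent (fundamentalRep (Fin N)) E e₀, linkHSComponent (fundamentalRep (Fin N)) E e;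
        wilsonMeasure (d := d) (L := L) (fundamentalRep (Fin N)) ((N : ℝ) * β)]| ≤
      frobNorm E ^ 2 / ((N : ℝ) / 2 - N * |β| * (4 * d)) := by
  obtain ⟨h0, h1⟩ := torus_linkSusceptibility_sun (d := d) (L := L) hN hK e₀ E
  have hv1 := torus_linkField_variance_sun (d := d) (L := L) hN hK E e₀
  have hv0 : 0 ≤ Var[linkHSComponent (fundamentalRep (Fin N)) E e₀; wilsonMeasure (d := d) (L := L) (fundamentalRep (Fin N)) ((N : ℝ) * β)] :=
    variance_nonneg _ _
  have hXm : AEMeasurable (linkHSComponent (fundamentalRep (Fin N)) E e₀ : GaugeConfig d L (SUN N) → ℝ)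
      (wilsonMeasure (d := d) (L := L) (fundamentalRep (Fin N)) ((N : ℝ) * β)) := by
    have hgc : Continuous fun U : SUN N => ((fundamentalRep (Fin N) U : Matrix (Fin N) (Fin N) ℂ) * Eᴴ).trace.re :=
      Complex.continuous_re.comp ((continuous_id.matrix_trace).comp
        (((continuous_fundamentalRep (n := Fin N)).matrix_mul continuous_const)))
    exact (hgc.measurable.comp (measurable_pi_apply e₀)).aemeasurable
  rw [Finset.sum_erase_eq_sub (Finset.mem_univ e₀), covariance_self hXm, abs_sub_le_iff]
  constructor <;> linarith

end LinkField

/-! ## §4. The parameterised shape for every `SU(N)`, `d`, and the named facts for `N ≤ 2` -/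

/-- ★★★ **`SZZLinkSusceptibilityBound (fundamentalRep (Fin N)) d (Nβ) 2 K'` for every `N ≥ 1`, `d`, every `|β| < 1/(8d)` and every `0 < K' ≤ N/2 − 4dN|β|`**:
on every torus, every link `e₀`, every unit `E` (`Re Tr(EE^*) = 1`): `Σ_e Cov(⟨Q_{e₀},E⟩,⟨Q_e,E⟩) ≤ 2/K'` and `|Σ_{e ≠ e₀} Cov(…)| ≤ 4/K'` (even `1/K'`
for both).  The Yang–Mills mass gap is NOT proved. [cite: ShenZhuZhu2022, Corollary 4.7] -/
theorem szzLinkSusceptibilityBound_sun {d N : ℕ} (hN : 1 ≤ N) {β : ℝ} {K : ℝ} (hK : 0 < K)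
    (hKle : K ≤ (N : ℝ) / 2 - N * |β| * (4 * d)) :
    SZZLinkSusceptibilityBound (fundamentalRep (Fin N)) d ((N : ℝ) * β) 2 K := by
  intro L _ _ e₀ E hE
  have hN0 : N ≠ 0 := by omega
  have hKv : 0 < (N : ℝ) / 2 - N * |β| * (4 * d) := lt_of_lt_of_le hK hKle
  have hn : frobNorm E ^ 2 = 1 := by rw [frobNorm_sq_eq_re_trace, Matrix.trace_mul_comm, hE]
  obtain ⟨_, h1⟩ := torus_linkSusceptibility_sun (d := d) (L := L) hN0 hKv e₀ E
  have h2 := torus_linkSusceptibility_offDiag_sun (d := d) (L := L) hN0 hKv e₀ E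
  rw [hn] at h1 h2
  have hcmp : 1 / ((N : ℝ) / 2 - N * |β| * (4 * d)) ≤ 1 / K := one_div_le_one_div_of_le hK hKle
  constructor
  · calc _ ≤ 1 / ((N : ℝ) / 2 - N * |β| * (4 * d)) := h1
      _ ≤ 1 / K := hcmp
      _ ≤ 2 / K := by rw [div_le_div_iff_of_pos_right hK]; norm_num
  · calc _ ≤ 1 / ((N : ℝ) / 2 - N * |β| * (4 * d)) := h2
      _ ≤ 1 / K := hcmp
      _ ≤ 2 * 2 / K := by rw [div_le_div_iff_of_pos_right hK]; norm_num

/-- ★★★ **The named facts `shenZhuZhu_linkSusceptibility d N` (Shen–Zhu–Zhu CMP 400 (2023), Cor. 4.7) for `N ∈ {1, 2}` and EVERY dimension `d`**: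
the `SU(N)` conjunct on SZZ's window `|β| < 1/(16(d−1))` (`⊆ {|β| < 1/(8d)}` for `d ≥ 2`) with the printed constants `2/K_S`, `4/K_S`,
`K_S = N/2 − 8N(d−1)|β| ≤ N/2 − 4dN|β|`; the `SO(N)` conjunct is vacuous for `N ≤ 2` (SZZ's threshold `1/(32(d−1)) − 1/(16N(d−1)) ≤ 0`).  STRONG
coupling, fixed finite tori; the Yang–Mills mass gap is NOT proved. [cite: ShenZhuZhu2022, Corollary 4.7] -/
theorem shenZhuZhu_linkSusceptibility_of_le_two {d N : ℕ} (hN2 : N ≤ 2) : shenZhuZhu_linkSusceptibility d N := by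
  refine ⟨fun hd hN β hβ => ?_, fun hd hN β hβ => ?_⟩
  · have hd' : (2 : ℝ) ≤ d := by exact_mod_cast hd
    have hN' : (1 : ℝ) ≤ N := by exact_mod_cast hN
    have hKS : 0 < szzBakryEmeryConstSU N d β := (szzBakryEmeryConstSU_pos_iff hd hN β).2 hβ
    refine szzLinkSusceptibilityBound_sun hN hKS ?_
    simp only [szzBakryEmeryConstSU]
    have h0 : 0 ≤ (N : ℝ) * |β| := mul_nonneg (by linarith) (abs_nonneg β)
    nlinarith
  · exfalso
    have hd' : (2 : ℝ) ≤ d := by exact_mod_cast hd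
    have hN' : (1 : ℝ) ≤ N := by exact_mod_cast hN
    have hN2' : (N : ℝ) ≤ 2 := by exact_mod_cast hN2
    have hT : szzThresholdSO N d ≤ 0 := by
      simp only [szzThresholdSO]
      rw [sub_nonpos, one_div_le_one_div (by nlinarith) (by nlinarith)]
      nlinarith
    exact absurd (hβ.trans_le hT) (not_lt.2 (abs_nonneg β))

end Summit.QuantumFields.YangMills.Theorems.ColdStartUniversality

end
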